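import Summits.CriticalPhenomena.PercolationContinuityZ3.Theorems.PercNearOneGluingNoHeavyLowerTailSahiThreeCopyCellC8Masks5

/-!
# `NoHeavyLowerTail` (crux stmt-CriticalPhenomena-4575), Sahi programme: `LawGood` for the slot `C8` at the interior profiles, mask by mask (part 6)

Support file (Sahi cell, seat `prim-sahi-p1`, generation 65; `--supports stmt-CriticalPhenomena-4575`).  Each interior profile `prof8 m` is a relabelling
(by an automorphism of the slot) of a certified class representative (`…CellC8p*` / class files); COMPUTATIONAL only through `native_decide` on the
invariance of the slot under the relabelling (a `Finset (Pt 8)` identity) and the inherited cell checks. [this work]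
-/

namespace Summit.CriticalPhenomena.PercolationContinuityZ3.Theorems.SahiThreeCopy

open Finset Function Literature.Combinatorics.Sahi2008
open scoped BigOperators

/-- Interior profile `prof8 253` (relabelled from the class representative `prof8 254`). [this work] -/
theorem lawGood_C8m253 : LawGood 8 (prof8 253) (fun x => (c8Z x : ℝ)) := by
  have h := lawGood_relab (k := 8) (Equiv.swap (0 : Fin 8) 1) (π := prof8 254) (f := (fun x => (c8Z x : ℝ)))
    (by rw [c8Z_comp_relab_eq _ (by native_decide)]; exact lawGood_C8p12222222)
  have hπ : prof8 253 = prof8 254 ∘ (Equiv.swap (0 : Fin 8) 1) := by funext i; fin_cases i <;> rfl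
  rw [hπ]; exact h

end Summit.CriticalPhenomena.PercolationContinuityZ3.Theorems.SahiThreeCopy
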